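import Literature.MathematicalPhysics.QuantumFieldTheory.Balaban1983to89.B8Thm4MultiLevelTorus
import Literature.MathematicalPhysics.QuantumFieldTheory.Balaban1983to89.B6KLevelFamilyWitnessV1
import Literature.MathematicalPhysics.QuantumFieldTheory.Balaban1983to89.B8SectGH

/-!
# `Balaban1983to89.B8LeafModelV1` — T. Bałaban, *Spaces of regular gauge field configurations on a lattice and gauge fixing
# conditions*, Commun. Math. Phys. **99** (1985) 75–102 [Balaban1985RegularSpaces] = cell paper B8, DAG node **N05**: the
# GAUGE-FIXING GROUP of the leaf `DagBinding.B8LeafR` — Theorem 2 p. 83 (`t2`), Proposition 3 p. 87 (`p3`), Theorem 4 p. 88 (`t4`),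
# as the ABSTRACT leaf `Prop`s `B8.Thm2Printed`, `B8.Prop3Printed`, `B8.Thm4Printed` — together with the six carrier laws of the
# knit `B8LeafKnit.b8LeafR_knit`, INSTANTIATED IN THE KERNEL on print's own multi-level carrier AT THE FLAT BACKGROUND `U₀ = 1`:
# the `k`-level V1 torus family of the lit-balaban r05 ∕ p21 ∕ r03 ∕ p38 lineage, packaged as a `B8SectGH.GFData3` family

statement-level skeleton of published theorems with citation tags; proofs where landed; nothing here is a claim about the Yang–Mills mass gap

CITATION HEADER (lean-in-tree rule).  Cell `pub-ymgap` (YM-PLAN Track A, HUMAN RULING D-0062 «Track A at full width»), seat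
`pub-ymgap-dag-n05-a` = the KNIT-BY-NAME seat of node N05 (`Dag.B8_main ℓ := ℓ.b5 → ℓ.b6 → ℓ.b7 → ℓ.b9 → ℓ.b8`, `Dag.lean` :198;
leaf `b8 ↦ DagBinding.B8LeafR` :845; knit of record `B8LeafKnit` p408782).  PDF held: `paper:balaban1985-cmp99-regular-spaces-gauge-fixing`
(journal page = PDF page + 74).  The printed sentences of Theorem 2, Proposition 3, Theorem 4 are quoted VERBATIM in the docstrings of
`B8.Thm2Printed`, `B8.Prop3Printed` ∕ `B8.Prop3Body`, `B8.Thm4Printed` (reader r1 ∕ sub-cell b08) and of the V1 theorems consumed here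
(`B8Thm4MultiLevelTorus`, `B8Prop3MultiLevelTorusP26`, own lineage lit-balaban r05); this file re-quotes only the clauses it reads.
[B6] = T. Bałaban, *Propagators and renormalization transformations for lattice gauge theories. II*, Commun. Math. Phys. **96** (1984)
223–250 [Balaban1984PropagatorsII] — (2.1)–(2.4) p. 224 (the nested torus family), (2.16) p. 225 (the weights `a_j`), through p21's ∕ r03's
verbatim quotations in `B6MultiLevelTorusOperator` ∕ `B6GlobalChartV1` ∕ `B6CubeWindowV1`.

WHY (the N05 knit's open list).  `B8LeafKnit.b8LeafR_knit` (§2 there) proves the faithful leaf from EIGHT named printed statements, Theorem 2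
being DERIVED by `B8.thm2_of_thm4_prop3` (print p. 88 «Thus Theorem 4 implies Theorem 2») from `t4`, `p3` and SIX displayed carrier laws
(`h165`, `hginv`, `h137`, `h136_162`, `hmono162`, `hmono137`); five of the nine conjuncts (`t2 p3 t4 p7 t8`) read ONE gauge-fixing family
`fam8R : I → B8SectGH.GFData3`, and NODE 00 has not pinned which family is «of record» (question N0-6).  Before this file NO family in the
tree carried a kernel instance of `B8.Thm2Printed`, `B8.Prop3Printed` or `B8.Thm4Printed`: the r05 lineage proved Theorems 2, 4, 8 and
Proposition 3 at `U₀ = 1` on the `k`-level torus «in their own quantifier shape» (`B8Thm4MultiLevelTorus.thm4_multiLevelTorus_V1`,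
`thm2_multiLevelTorus_V1`, `B8Prop3MultiLevelTorusP26.prop3_multiLevelTorus_V1_P26_vector`), and the only packaged `GFData3` families were
REFUTATION packagings (`B8Thm8FlatAbelianFamily.flatGF`, `B8Prop7HalfSpace.halfspaceGF`: conclusion fields `True` where not read) and
print's admitted family for Prop. 7 alone (`B8Prop7AdmittedFamily`).  This file supplies the POSITIVE packaging: an HONEST `GFData3` family
(every field read by `t2 p3 t4` and by the six laws is the genuine printed predicate of the instance, conclusions in print's STRICT form)
on which the abstract leaf `Prop`s are THEOREMS — the shape in which a -b seat's estimate «counts for the knit» (seat README), and the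
pattern NODE 00 needs for N0-6.

THE INSTANCE (dictionary print ↦ Lean; = `B8Thm4MultiLevelTorus`'s «THE INSTANCE» word for word, now as carrier FIELDS).  Index
`i : V1Idx d ℓ hd hL b₀ b₁ M` = one admissible `k`-level V1 torus: dimension `d + 1`, `L = ℓ + 1` odd `≥ 5`, torus of record
`PV d ℓ m K hd hL` identified with p21's torus (`hN`), a nested family `D : TDomains` (`Ω₁ ⊃ … ⊃ Ω_k`, (2.1)–(2.2) [B6] built in), `k ≥ 1`,
`M_h = L^a ≥ 8`, `R ≥ 2L²`, `P′ ≥ 5L`, the size threshold `M ≤ L·M_h` («M sufficiently large», a family PARAMETER), the unit factor `c′ ≠ 0`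
(`η = |c′|⁻¹`) and weights in the band (2.16).  `v1GF i : B8SectGH.GFData3`: `Cfg := Unit` (**`U₀ = 1` ONLY** — the one modelling
restriction); `Pert` = the real bond fields `A′` (`U′ = e^{iηA′}`, linear∕abelian chart); `GT` = `Src` = site functions (`u = e^{iλ}`, sources
`f`); `InA α₀ 1`, `Reg335 α₀ 1` := `0 < α₀` ((1.33) and [4] (3.35) hold at `U₀ = 1` for every `α₀ > 0`); `InAAx α₀ 1 A′` := (1.34) in the
PROCESSED form through which it enters the printed proof at `U₀ = 1`, (1.55) p. 86: `|(D^{η*}D^ηA′)(b)| < 2α₀((L^{j(b)})η)⁻³` (the α₂-terms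
of (1.55) vanish in the linear chart; the axial-gauge clause `Ax_k(𝔅_k, U₀)` of (1.34) is NOT modelled — not needed at `U₀ = 1`, HONEST
SCOPE (iii)); `avgClose α₁ 1 A′` = `avgClose166 α₁ 1 A′` := (1.35)∕(1.66) processed through (1.37)∕(1.56): `|(Q_jA′)(c)| < 2dLα₁(Lʲη)⁻¹` on
`Λ_j`; `Restricted 1 λ` := (1.29) `λ ∈ N(Q′)` ([B6] (2.7)); `act A′ λ := A′ − ∂λ` ((1.17)); `C136 B₁ B₂ s 1 A` := the two SUP members of (1.36)
in print's norm (`B8ScaledSupNorm.msup`, p. 86), `|A|₍₋₁₎ < B₁s`, `|∇^η_{U₀}A|₍₋₂₎ < B₁s` (`∇ = DV·c′`, p38) — the Hölder member `‖A‖_{1,β}`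
is NOT part of the instance (as in `B8Thm4MultiLevelTorus`, HONEST SCOPE (ii)); `C137 α₁ 1 A` := (1.37) `|Q_j(ηA)| < 2dLα₁(Lʲη)⁻¹` on `Λ_j`;
`Landau 1 A` := (1.38) `R∂*A = 0` (p21's `RE`, [B6] (2.12)); `C139 B₁ s 1 A` := (1.39) `|D^{η*}D^ηA|(b) < B₁s((L^{j(b)})η)⁻³` and
`|Δ^ηA|₍₋₃₎ < B₁s`; `C162 B s 1 A` := (1.62) `|A|₍₋₁₎ < Bs`; `InAPair α₀ 1 A` := the second clause of (1.40) processed as `InAAx`;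
`fNorm f` := `|f|₍₋₂₎`, `fGrad 1 f` := `|∂f|₍₋₃₎`, `InR 1 f` := `Rf = f`, `LandauF 1 f A` := (1.146) `R∂*A = f`, `C140 α₂ 1 A` := all three
members of (1.140) (these five are read only by Prop. 7 ∕ Thm 8, not by this file's theorems; typed faithfully for the successor file).

WHAT THIS FILE PROVES (0 sorry; axioms standard; 2 definitions `V1Idx`, `v1GF`; 10 theorems).
§1 THE SIX CARRIER LAWS of `B8.thm2_of_thm4_prop3` ∕ `B8LeafKnit.b8LeafR_knit` HOLD on every `v1GF i`: `c136_c162` ((1.62) ⊂ (1.36),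
   `h136_162`), `c162_mono`, `c137_mono` (monotonicity in the constants), `inAPair_act` (`hginv`: gauge invariance of `𝔄_k` — at `U₀ = 1`,
   `D*D(A′ − ∂λ) = D*DA′`, p21's `curlCurl_comp_dE`), `c137_act` (`h137`: «(1.37) is basically of an algebraic character», `Q(A′ − ∂λ) =
   QA′` for restricted `λ`, `B8Thm4MultiLevelTorus.data_of_restricted`), `avgClose166_of_avgClose` (`h165`: (1.65) with `11d²α₀ + α₁`, here
   by monotonicity since both sides are the processed `Q_j`-bound).
§2 `thm4Printed_v1` — **`B8.Thm4Printed B′₁ (v1GF ·)`**: ONE threshold `M₀ > 0` and ONE `B₁m ≥ 1` (on `d, L, b₀, b₁`) such that for every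
   family parameter `M ≥ M₀` and every `B′₁ ≥ B₁m` Theorem 4's SENTENCE holds on the family — from `thm4_multiLevelTorus_V1` (∃! restricted
   Landau `λ`; `|A|₍₋₁₎ ≦ 5dLB′₀(α₀ + α₁)`), print's strict `<` with `B₁m = 5dLB′₀ + 1`; `c₁ := 1` nominal (no smallness is needed at `U₀ = 1`).
§3 `thm2Printed_v1` — **`B8.Thm2Printed (v1GF ·)`** for `M ≥ M₀`, and its body at EVERY `B₂ > 0` (the Hölder constant is idle in the
   instance): ∃! restricted Landau `λ`, (1.36) sup members, (1.37), (1.38), (1.39) — from `thm4_multiLevelTorus_V1` (all members).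
§4 `prop3Printed_v1` — **`B8.Prop3Printed (d+1) L C₂ inp B₀(β₀) (v1GF ·)`** for `M ≥ M₀`, every `C₂ ≥ 0`, every `B₀(β₀)`, every B9-input
   record with `inp.B₀ = B′₀ + 1` (`B′₀ = K_L(B₀A + 1)(1 + 2b₁)` of `prop3_multiLevelTorus_V1_P26_vector`, the genuine `k`-level `G(1)`):
   the hypotheses (1.40)–(1.42) of the instance feed r05's Prop. 3 with `J := D*DA`, `n_J = 2α₀`, `B := QA`, `n_B = 2dLα₁`; Prop. 3's
   threshold «α₀, α₁, α₂ bounded by a constant depending on d and L only» IS USED: `c = min(1∕(72dB′₀), 1∕(50d))` delivers the two side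
   conditions of the a-priori algebra (p. 86 «B₀36dα₂ ≦ 1∕2»; `50dα₂ ≦ 1`, census C-B8-8); (1.61) is passed through verbatim.
§5 `exists_v1Idx` — NON-VACUITY for every `d`, every odd `L ≥ 5`, every `k ≥ 2`, EVERY threshold `M` and every band `0 < b₀ ≤ b₁`: an index
   with torus `P′ = 2L²`, `R = 2L²`, `M_h = L^a`, `c′ = 1`, band weights (`B6KLevelFamilyWitnessV1.globalBand_witness`) and a genuinely NESTED
   family with sites at both top levels `k` and `k − 1` (`B6V1TorusWitness.exists_twoTop_TDomains`) — so §2–§4 and §6 are not about an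
   empty index type.
§6 `thm2Printed_v1_knit` — **THEOREM 2 BY THE KNIT'S PRINTED ROUTE on the instance**: `B8.thm2_of_thm4_prop3 (d+1) L 0 B′₁ inp 1 (v1GF ·)`
   fed with §2 (`B′₁ := max(B₁m, 5dL·inp.B₀)`), §4 (`C₂ = 0`, `B₀(β₀) = 1`) and the six laws of §1 ELABORATES and proves
   `B8.Thm2Printed (v1GF ·)` a second time — the sub-cell's explicit schedule `B8.thm2_schedule_exists` and the law list of the N05 knit are
   jointly satisfiable by a non-degenerate family (a consistency certificate for the knit of record, p408782 §2).

HONEST SCOPE ∕ NOT CLAIMED.  (i) **A MODEL INSTANCE, NOT A NODE DISCHARGE**: `Cfg = Unit` — every «for arbitrary U₀ … satisfying (1.33)»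
of print is read at the single flat background `U₀ = 1`, where the nonlinear gauge fixing of Sects. C–E degenerates to p21's linear algebra
over [B6]'s projection `R`; the YM-PLAN §1 vacuity audit (A-list: one-point background type) classifies any use of this family toward N05
as a MODEL, and this file claims nothing else; counts unmoved (typed 28∕28, discharged unchanged).  (ii) NOT part of the instance: the
Hölder member of (1.36)∕(1.62) (so `B₂`, `B₀(β₀)` are idle), non-abelian fibres (real scalar fibre), the conjuncts `l1 p5e p5u p6 p7 t8` of
the leaf (other carriers ∕ Sects. D–H; `t8` AS TYPED is refuted on the admitted flat instances, `B8LeafKnit` §4 — its surviving form on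
this family is the successor file's).  (iii) HYPOTHESIS FIELDS IN PROCESSED FORM: (1.34)∕(1.35)∕(1.66) enter as their (1.55)∕(1.56)∕(1.37)
consequences at `U₀ = 1` (r05's reading, `B8Thm4MultiLevelTorus` HONEST SCOPE (iii)); reading `𝔄_k`-membership of `e^{iηA′}` itself needs the
a-priori smallness only the theorem provides (print's own order, p. 83) and the axial gauge `Ax_k` is not modelled — immaterial for `t2 t4`
(hypotheses) and for `p3` ((1.40) second clause), but it is the reason Prop. 7 ((1.144) concludes `∈ Ax_k`) is NOT instantiated here.
(iv) CONSTANTS: existential in `d, L, b₀, b₁` through r05's `σ₀`-admissible rate (taken at `σ = σ₀`, budget `α = 1∕2`); print: «depend on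
d and L only» — the band `[b₀, b₁]` is print's fixed `a_j`, the rate∕budget are [B6]-internal; ONE size threshold `M₀ ≤ L·M_h` per theorem.
(v) IN-EDGES: nothing of the leaves b5, b6, b7, b9 is consumed — the [B6] content underneath (Prop. 2.6 at `k` levels for `G(1)`) is
PROVED for this model by the p21 ∕ r03 ∕ p38 ∕ r05 lineage, hypothesis-free.  (vi) One finite four-torus programme at fixed ε, Bałaban AS
PRINTED with locators; nothing continuum ∕ ℝ⁴ ∕ OS ∕ mass gap ∕ Clay.

RELATED IN THE TREE, NOT DUPLICATED: `B8LeafKnit` (the abstract knit; §1 here are its law hypotheses discharged on an instance),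
`B8Thm4MultiLevelTorus` ∕ `B8Prop3MultiLevelTorusP26` (the theorems packaged — used BY NAME, nothing re-proved), `B6KLevelCensusIndexV1.KIdx`
(p38's index of the same family with `k ≥ 2`, `Placed`, `P′ ≥ 5` — a different binder list; `V1Idx` is the binder list of the B8-side
theorems: `k ≥ 1`, `P′ ≥ 5L`, the threshold `M`), `B8Thm8FlatAbelianFamily.flatGF` (one-level refutation packaging on `Site P 0`).
-/

open scoped BigOperators

namespace Literature.MathematicalPhysics.QuantumFieldTheory.Balaban1983to89.B8LeafModelV1

open B6MultiLevelBoxOperator (N0)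
open B6MultiLevelTorusOperator (TDomains)
open B6Geom246MultiLevelTorus (geomT)
open B6GlobalChartV1 (PV domT blkV1)
open B8Ineq192MultiLevelTorus (lenT_pos)
open B6SectAOperatorsV1 (dE dsE dcE dcsE QE QpE RE ScalarSpace BondIdx)
open B6SectACriticalPointV1 (QE_dE_eq_zero curlCurl_comp_dE)
open B6CubeWindowV1 (GlobalBand)
open B6GradLegKLevelV1 (DV)
open BalabanImbrieJaffe1984to88.BIJ85AxialPropagator411 (BondSpace)
open B8ScaledSupNorm (msup msup_nonneg)
open LatticeFieldCalculus (laplace)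
open B6ScalarFactorsChartV1 (blkS)
open B8Thm4MultiLevelTorus (thm4_multiLevelTorus_V1 data_of_restricted)
open B8Prop3MultiLevelTorusP26 (prop3_multiLevelTorus_V1_P26_vector)
open B8Prop3MultiLevelTorusEta (pointwise_of_msup_le_blk_eta msup_le_of_pointwise_blk_eta)
open B4Reflection242 (boxDom mem_boxDom)
open B6KLevelFamilyWitnessV1 (N0_V1_pow globalBand_witness exists_exponent)
open B6V1TorusWitness (topLev_zero topLev_corner corner_mem_boxDom exists_twoTop_TDomains)

noncomputable section

variable (d ℓ : ℕ) (hd : 1 ≤ d + 1) (hL : Odd (ℓ + 1) ∧ 1 < ℓ + 1) (b₀ b₁ M : ℝ)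

/-- **The index of the `k`-level V1 torus family read by [B8]'s theorems at `U₀ = 1`** — the binder list of
`B8Thm4MultiLevelTorus.thm4_multiLevelTorus_V1` ∕ `B8Prop3MultiLevelTorusP26.prop3_multiLevelTorus_V1_P26_vector` made a structure:
V1 parameters `m, K` of the torus of record, p21's nested torus family `D` ([B6] (2.1)–(2.4): `Ω₁ ⊃ … ⊃ Ω_k` with big blocks of size
`M = L·M_h` and the separation integer `R`) whose torus IS the V1 torus (`hN`), `k ≥ 1`, `k ≤ m + K`, `M_h = L^a ≥ 8`, `R ≥ 2L²`,
`P′ ≥ 5L`, odd `L = ℓ + 1 ≥ 5`, the size threshold `M ≤ L·M_h` («M sufficiently large» — the family PARAMETER `M`), the unit factor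
`c′ ≠ 0` (`η = |c′|⁻¹`) and the weights `a_j` of (2.16) in the band `[b₀, b₁]` (`B6CubeWindowV1.GlobalBand`).
[cite: Balaban1984PropagatorsII, (2.1)–(2.4) p.224, (2.16) p.225] -/
structure V1Idx where
  /-- volume exponent of the torus of record -/
  m : ℕ
  /-- number of RG steps of the torus of record (`ε = L^{−K}`) -/
  K : ℕ
  /-- `M_h`: `M = L·M_h` is the size of the big blocks of (2.1)–(2.2) [B6] -/
  Mh : ℕ
  /-- number of levels `k` of the nested family `Ω₁ ⊃ … ⊃ Ω_k` -/
  k : ℕ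
  /-- the integer `R` of (2.2) [B6] -/
  R : ℕ
  /-- `M_h = L^a` -/
  a : ℕ
  /-- box half-widths of p21's fundamental box -/
  P' : Fin (d + 1) → ℕ
  /-- the torus of the family IS the V1 torus -/
  hN : ∀ μ, N0 ℓ Mh k P' μ = (PV d ℓ m K hd hL).sitesPerDir 0
  /-- the nested torus family `{Ω_j}` ((2.1)–(2.2) [B6] built in) -/
  D : TDomains d ℓ Mh k P' R
  hk : k ≤ m + K
  hk1 : 1 ≤ k
  hMha : Mh = (ℓ + 1) ^ a
  hM8 : 8 ≤ Mh
  hR2 : 2 * (ℓ + 1) ^ 2 ≤ R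
  hP5 : ∀ μ, 5 * (ℓ + 1) ≤ P' μ
  hℓ4 : 4 ≤ ℓ
  /-- the size threshold «M sufficiently large»: `M ≤ L·M_h` -/
  hM : M ≤ ((ℓ : ℝ) + 1) * Mh
  /-- the V1 unit factor `c′ ≠ 0` (`η = |c′|⁻¹`) -/
  cf : ℝ
  hcf : cf ≠ 0
  /-- the weights `a_j` of (2.16) [B6] in the band `[b₀, b₁]` -/
  w : BondIdx (domT hN D hk) → ℝ
  hw : ∀ i, 0 < w i
  hwb : GlobalBand b₀ b₁ cf w

variable {d ℓ hd hL b₀ b₁ M}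

/-- **The `k`-level V1 torus at `U₀ = 1` packaged as pv17's faithful carrier `B8SectGH.GFData3`** (field-by-field reading in the
module docstring, THE INSTANCE).  Backgrounds `Cfg = {U₀ = 1}`; perturbations `Pert` = real bond fields `A′` on the torus of record
(`U′ = e^{iηA′}`); gauge transformations and sources = site functions; `k = i.k`.  HYPOTHESIS fields: `InA α₀ 1`, `Reg335 α₀ 1` :=
`0 < α₀` ((1.33), [4] (3.35) at `U₀ = 1`); `InAAx α₀ 1 A′` := (1.34) processed through (1.55), `|(D^{η*}D^ηA′)(b)| < 2α₀((L^{j(b)})η)⁻³`;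
`avgClose α₁ 1 A′` = `avgClose166 α₁ 1 A′` := (1.35)∕(1.66) processed through (1.37)∕(1.56), `|(Q_jA′)(c)| < 2dLα₁(Lʲη)⁻¹` on `Λ_j`;
`InAPair α₀ 1 A` := the second clause of (1.40) processed likewise; `InR 1 f` := «f from the space R(U₀)», `Rf = f`.  CONCLUSION fields,
print's STRICT inequalities in print's norm `|·|₍₋ₙ₎ = B8ScaledSupNorm.msup (ℓ+1) k η (−n)` (p. 86): `Restricted 1 λ` := (1.29) `λ ∈ N(Q′)`;
`act A′ λ := A′ − ∂λ`; `C136 B₁ B₂ s` := `|A|₍₋₁₎ < B₁s ∧ |∇^η_{U₀}A|₍₋₂₎ < B₁s` (the Hölder member is NOT part of the instance);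
`C137 α₁` := `|Q_j(ηA)| < 2dLα₁(Lʲη)⁻¹` on `Λ_j`; `Landau` := (1.38) `R∂*A = 0`; `C139 B₁ s` := `|D^{η*}D^ηA|(b) < B₁s((L^{j(b)})η)⁻³ ∧
|Δ^ηA|₍₋₃₎ < B₁s`; `C162 B s` := `|A|₍₋₁₎ < Bs`; `LandauF 1 f A` := (1.146) `R∂*A = f`; `fNorm f` := `|f|₍₋₂₎`; `fGrad 1 f` := `|∂f|₍₋₃₎`;
`C140 α₂` := all three members of (1.140).
[cite: Balaban1985RegularSpaces, (1.29) p.81 + (1.33)–(1.39) pp.82–83 + (1.40)–(1.42) pp.83–84 + (1.55)–(1.56) p.86 + (1.62) p.87 + (1.66) p.87 + (1.140) p.100 + (1.146) p.101] -/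
def v1GF (i : V1Idx d ℓ hd hL b₀ b₁ M) : B8SectGH.GFData3 where
  Cfg := Unit
  Pert := BondSpace (PV d ℓ i.m i.K hd hL)
  GT := ScalarSpace (PV d ℓ i.m i.K hd hL)
  Src := ScalarSpace (PV d ℓ i.m i.K hd hL)
  k := i.k
  InA := fun α₀ _ => 0 < α₀
  Reg335 := fun α₀ _ => 0 < α₀
  InAAx := fun α₀ _ A' => ∀ b : PBond (PV d ℓ i.m i.K hd hL) 0,
    |dcsE i.cf (dcE i.cf A') b| < 2 * α₀ * (((geomT i.D).len (blkV1 i.hN i.D b) * |i.cf|⁻¹) ^ 3)⁻¹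
  avgClose := fun α₁ _ A' => ∀ c : BondIdx (domT i.hN i.D i.hk),
    |QE (domT i.hN i.D i.hk) A' c| < 2 * ((d : ℝ) + 1) * ((ℓ : ℝ) + 1) * α₁ * (((ℓ : ℝ) + 1) ^ (c.1.1 : ℕ) * |i.cf|⁻¹)⁻¹
  avgClose166 := fun α₁ _ A' => ∀ c : BondIdx (domT i.hN i.D i.hk),
    |QE (domT i.hN i.D i.hk) A' c| < 2 * ((d : ℝ) + 1) * ((ℓ : ℝ) + 1) * α₁ * (((ℓ : ℝ) + 1) ^ (c.1.1 : ℕ) * |i.cf|⁻¹)⁻¹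
  Restricted := fun _ n => n ∈ LinearMap.ker (QpE (domT i.hN i.D i.hk))
  act := fun A' n => A' - dE i.cf n
  C136 := fun B₁ _ s _ A =>
    msup (ℓ + 1) i.k |i.cf|⁻¹ (-1) (fun j (b : PBond (PV d ℓ i.m i.K hd hL) 0) => j ≤ (blkV1 i.hN i.D b).1.1) (WithLp.ofLp A) <
        B₁ * s ∧
      msup (ℓ + 1) i.k |i.cf|⁻¹ (-2) (fun j (p : Fin (d + 1) × PBond (PV d ℓ i.m i.K hd hL) 0) => j ≤ (blkV1 i.hN i.D p.2).1.1)
        (fun p : Fin (d + 1) × PBond (PV d ℓ i.m i.K hd hL) 0 => DV (P := PV d ℓ i.m i.K hd hL) p.1 i.cf (WithLp.ofLp A) p.2) <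
        B₁ * s
  C137 := fun α₁ _ A => ∀ c : BondIdx (domT i.hN i.D i.hk),
    |QE (domT i.hN i.D i.hk) A c| < 2 * ((d : ℝ) + 1) * ((ℓ : ℝ) + 1) * α₁ * (((ℓ : ℝ) + 1) ^ (c.1.1 : ℕ) * |i.cf|⁻¹)⁻¹
  Landau := fun _ A => RE (domT i.hN i.D i.hk) i.cf (dsE i.cf A) = 0
  C139 := fun B₁ s _ A =>
    (∀ b : PBond (PV d ℓ i.m i.K hd hL) 0,
        |dcsE i.cf (dcE i.cf A) b| < B₁ * s * (((geomT i.D).len (blkV1 i.hN i.D b) * |i.cf|⁻¹) ^ 3)⁻¹) ∧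
      msup (ℓ + 1) i.k |i.cf|⁻¹ (-3) (fun j (b : PBond (PV d ℓ i.m i.K hd hL) 0) => j ≤ (blkV1 i.hN i.D b).1.1)
        (fun b : PBond (PV d ℓ i.m i.K hd hL) 0 => laplace i.cf (fun z => A ⟨z, b.dir⟩) b.src) < B₁ * s
  C162 := fun B s _ A =>
    msup (ℓ + 1) i.k |i.cf|⁻¹ (-1) (fun j (b : PBond (PV d ℓ i.m i.K hd hL) 0) => j ≤ (blkV1 i.hN i.D b).1.1) (WithLp.ofLp A) <
      B * s
  fNorm := fun f =>
    msup (ℓ + 1) i.k |i.cf|⁻¹ (-2) (fun j (x : Site (PV d ℓ i.m i.K hd hL) 0) => j ≤ (blkS i.hN i.D x).1.1) (WithLp.ofLp f)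
  LandauF := fun _ f A => RE (domT i.hN i.D i.hk) i.cf (dsE i.cf A) = f
  InAPair := fun α₀ _ A => ∀ b : PBond (PV d ℓ i.m i.K hd hL) 0,
    |dcsE i.cf (dcE i.cf A) b| < 2 * α₀ * (((geomT i.D).len (blkV1 i.hN i.D b) * |i.cf|⁻¹) ^ 3)⁻¹
  fGrad := fun _ f =>
    msup (ℓ + 1) i.k |i.cf|⁻¹ (-3) (fun j (b : PBond (PV d ℓ i.m i.K hd hL) 0) => j ≤ (blkV1 i.hN i.D b).1.1)
      (WithLp.ofLp (dE i.cf f))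
  C140 := fun α₂ _ A =>
    msup (ℓ + 1) i.k |i.cf|⁻¹ (-1) (fun j (b : PBond (PV d ℓ i.m i.K hd hL) 0) => j ≤ (blkV1 i.hN i.D b).1.1) (WithLp.ofLp A) <
        α₂ ∧
      msup (ℓ + 1) i.k |i.cf|⁻¹ (-2) (fun j (p : Fin (d + 1) × PBond (PV d ℓ i.m i.K hd hL) 0) => j ≤ (blkV1 i.hN i.D p.2).1.1)
        (fun p : Fin (d + 1) × PBond (PV d ℓ i.m i.K hd hL) 0 => DV (P := PV d ℓ i.m i.K hd hL) p.1 i.cf (WithLp.ofLp A) p.2) <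
        α₂ ∧
      msup (ℓ + 1) i.k |i.cf|⁻¹ (-3) (fun j (b : PBond (PV d ℓ i.m i.K hd hL) 0) => j ≤ (blkV1 i.hN i.D b).1.1)
        (fun b => dcsE i.cf (dcE i.cf A) b) < α₂
  InR := fun _ f => RE (domT i.hN i.D i.hk) i.cf f = f

/-! ## §1 The six carrier laws of the knit hold on the instance -/

section Laws

variable (i : V1Idx d ℓ hd hL b₀ b₁ M)

/-- Law `h136_162` of the knit on the instance: (1.62) `|A|₍₋₁₎ < B₁s` IS the first member of (1.36).
[cite: Balaban1985RegularSpaces, (1.36) p.82 + (1.62) p.87] -/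
theorem c136_c162 (b b₂ s : ℝ) (U₀ : Unit) (A : BondSpace (PV d ℓ i.m i.K hd hL)) (h : (v1GF i).C136 b b₂ s U₀ A) :
    (v1GF i).C162 b s U₀ A :=
  h.1

/-- Law `hmono162` of the knit on the instance: the (1.62) bound is monotone in its constant `B·s`.
[cite: Balaban1985RegularSpaces, (1.62) p.87] -/
theorem c162_mono (b s b' s' : ℝ) (U₀ : Unit) (A : BondSpace (PV d ℓ i.m i.K hd hL)) (hle : b * s ≤ b' * s')
    (h : (v1GF i).C162 b s U₀ A) : (v1GF i).C162 b' s' U₀ A :=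
  lt_of_lt_of_le h hle

/-- Law `hmono137` of the knit on the instance: the (1.37) bound `|Q_j(ηA)| < 2dLα₁(Lʲη)⁻¹` is monotone in `α₁`.
[cite: Balaban1985RegularSpaces, (1.37) p.82] -/
theorem c137_mono (α₁ α₁' : ℝ) (U₀ : Unit) (A : BondSpace (PV d ℓ i.m i.K hd hL)) (hle : α₁ ≤ α₁')
    (h : (v1GF i).C137 α₁ U₀ A) : (v1GF i).C137 α₁' U₀ A := by
  intro c
  have hw : 0 ≤ (((ℓ : ℝ) + 1) ^ (c.1.1 : ℕ) * |i.cf|⁻¹)⁻¹ := by positivity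
  have h1 : 2 * ((d : ℝ) + 1) * ((ℓ : ℝ) + 1) * α₁ * (((ℓ : ℝ) + 1) ^ (c.1.1 : ℕ) * |i.cf|⁻¹)⁻¹ ≤
      2 * ((d : ℝ) + 1) * ((ℓ : ℝ) + 1) * α₁' * (((ℓ : ℝ) + 1) ^ (c.1.1 : ℕ) * |i.cf|⁻¹)⁻¹ :=
    mul_le_mul_of_nonneg_right (mul_le_mul_of_nonneg_left hle (by positivity)) hw
  exact lt_of_lt_of_le (h c) h1

/-- Law `hginv` of the knit on the instance — gauge invariance of `𝔄_k` («(1.34) ⇒ (U′U₀)^{u⁻¹} = U₁U₀ ∈ 𝔄_k», the second clause of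
(1.40)): at `U₀ = 1` in the linear chart the processed datum is literally invariant, `D^{η*}D^η(A′ − ∂λ) = D^{η*}D^ηA′` for EVERY `λ`
(curl of a gradient vanishes, p21's `B6SectACriticalPointV1.curlCurl_comp_dE`, [B6] (2.28)–(2.30)).
[cite: Balaban1985RegularSpaces, (1.34) p.82 + (1.40) p.83 + (1.55) p.86; Balaban1984PropagatorsII, (2.28)–(2.30) p.227] -/
theorem inAPair_act (α₀ : ℝ) (U₀ : Unit) (A' : BondSpace (PV d ℓ i.m i.K hd hL)) (n : ScalarSpace (PV d ℓ i.m i.K hd hL))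
    (h : (v1GF i).InAAx α₀ U₀ A') : (v1GF i).InAPair α₀ U₀ ((v1GF i).act A' n) := by
  intro b
  have h0 : dcsE i.cf (dcE i.cf (dE i.cf n)) = 0 := by
    have h := LinearMap.congr_fun (curlCurl_comp_dE (P := PV d ℓ i.m i.K hd hL) i.cf) n
    simpa only [LinearMap.comp_apply, LinearMap.zero_apply] using h
  have hre : dcsE i.cf (dcE i.cf (A' - dE i.cf n)) = dcsE i.cf (dcE i.cf A') := by
    rw [map_sub, map_sub, h0, sub_zero]
  show |dcsE i.cf (dcE i.cf (A' - dE i.cf n)) b| < _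
  rw [hre]
  exact h b

/-- Law `h137` of the knit on the instance — p. 83 «(1.37) is basically of an algebraic character and it follows from the
construction»: for a (1.29)-restricted `λ`, `Q_j(A′ − ∂λ) = Q_jA′` (`B8Thm4MultiLevelTorus.data_of_restricted`, p21's `QE_dE_eq_zero`), so
(1.35) for `A′` gives (1.37) for `A′ − ∂λ` with the same `α₁`; the (1.62)-hypothesis of the law is not needed here.
[cite: Balaban1985RegularSpaces, (1.37) p.82 + p.83; Balaban1984PropagatorsII, (2.7) p.224] -/
theorem c137_act (α₁ b s : ℝ) (U₀ : Unit) (A' : BondSpace (PV d ℓ i.m i.K hd hL)) (n : ScalarSpace (PV d ℓ i.m i.K hd hL))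
    (hcl : (v1GF i).avgClose α₁ U₀ A') (hn : (v1GF i).Restricted U₀ n) (_h162 : (v1GF i).C162 b s U₀ ((v1GF i).act A' n)) :
    (v1GF i).C137 α₁ U₀ ((v1GF i).act A' n) := by
  intro c
  show |QE (domT i.hN i.D i.hk) (A' - dE i.cf n) c| < _
  rw [(data_of_restricted (domT i.hN i.D i.hk) i.cf A' hn).1]
  exact hcl c

/-- Law `h165` of the knit on the instance — (1.65) p. 88 «|Ũ′ʲ − 1| < 11d²α₀ + α₁» ((1.33)–(1.35) ⇒ (1.66) with `α₁ ↦ 11d²α₀ + α₁`,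
Lemma 1 iterated + Prop. 2 of [3]): here both (1.35) and (1.66) are the processed `Q_j`-bound, so the law is monotonicity in `α₁`
(`0 < α₀`); the threshold `c₀` is idle. [cite: Balaban1985RegularSpaces, (1.65)–(1.66) pp.87–88] -/
theorem avgClose166_of_avgClose (c₀ α₀ α₁ : ℝ) (U₀ : Unit) (A' : BondSpace (PV d ℓ i.m i.K hd hL)) (hα₀ : 0 < α₀) (_hc₀ : α₀ ≤ c₀)
    (_hA : (v1GF i).InA α₀ U₀) (_hAx : (v1GF i).InAAx α₀ U₀ A') (hcl : (v1GF i).avgClose α₁ U₀ A') :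
    (v1GF i).avgClose166 (11 * ((d + 1 : ℕ) : ℝ) ^ 2 * α₀ + α₁) U₀ A' := by
  intro c
  have hw : 0 ≤ (((ℓ : ℝ) + 1) ^ (c.1.1 : ℕ) * |i.cf|⁻¹)⁻¹ := by positivity
  have hle : α₁ ≤ 11 * ((d + 1 : ℕ) : ℝ) ^ 2 * α₀ + α₁ := le_add_of_nonneg_left (by positivity)
  have h1 : 2 * ((d : ℝ) + 1) * ((ℓ : ℝ) + 1) * α₁ * (((ℓ : ℝ) + 1) ^ (c.1.1 : ℕ) * |i.cf|⁻¹)⁻¹ ≤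
      2 * ((d : ℝ) + 1) * ((ℓ : ℝ) + 1) * (11 * ((d + 1 : ℕ) : ℝ) ^ 2 * α₀ + α₁) * (((ℓ : ℝ) + 1) ^ (c.1.1 : ℕ) * |i.cf|⁻¹)⁻¹ :=
    mul_le_mul_of_nonneg_right (mul_le_mul_of_nonneg_left hle (by positivity)) hw
  exact lt_of_lt_of_le (hcl c) h1

end Laws

/-! ## §2 Theorem 4 (p. 88) as the abstract leaf `Prop` on the instance -/

section Thm4

/-- **`B8.Thm4Printed B′₁` ON THE `k`-LEVEL V1 TORUS FAMILY AT `U₀ = 1`.**  Print (p. 88, verbatim in `B8.Thm4Printed`): *"There exists a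
constant c₁ such that for arbitrary U₀, U′U₀ satisfying (1.33), (1.34), (1.66) with α₀ + α₁ ≤ c₁ there exists exactly one gauge
transformation u satisfying (1.29) and such that the conditions (1.37), (1.38), (1.62) hold for the configuration U₁ = U′^{u⁻¹}."*
There are ONE size threshold `M₀ > 0` and ONE constant `B₁m ≥ 1` (`= 5dLB′₀ + 1`, `B′₀` of `thm4_multiLevelTorus_V1`; on `d, L, b₀, b₁`)
such that for every family parameter `M ≥ M₀` and every `B′₁ ≥ B₁m` the abstract sentence `B8.Thm4Printed B′₁` holds for
`fun i : V1Idx … M => (v1GF i).toGFData`: existence and uniqueness of the restricted Landau `λ` = p21's `existsUnique_gauge212` inside r05's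
theorem; (1.37) by `data_of_restricted`; (1.62) from `|A|₍₋₁₎ ≦ 5dLB′₀(α₀ + α₁) < B′₁(α₀ + α₁)`.  `c₁ := 1` is nominal: no smallness is
needed at `U₀ = 1` in the linear chart (HONEST SCOPE (i)). [cite: Balaban1985RegularSpaces, Thm 4 p.88, (1.29) p.81, (1.37)–(1.38) p.82, (1.62) p.87; Balaban1984PropagatorsII, (2.7) p.224, (2.12) p.225] -/
theorem thm4Printed_v1 (d ℓ : ℕ) (hd : 1 ≤ d + 1) (hL : Odd (ℓ + 1) ∧ 1 < ℓ + 1) {b₀ b₁ : ℝ} (hb₀ : 0 < b₀) (hb₁ : b₀ ≤ b₁) :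
    ∃ M₀ B₁m : ℝ, 0 < M₀ ∧ 1 ≤ B₁m ∧ ∀ M : ℝ, M₀ ≤ M → ∀ B₁' : ℝ, B₁m ≤ B₁' →
      B8.Thm4Printed B₁' (fun i : V1Idx d ℓ hd hL b₀ b₁ M => (v1GF i).toGFData) := by
  obtain ⟨σ₀, hσ₀, h4⟩ := thm4_multiLevelTorus_V1 d ℓ hd hL hb₀ hb₁
  obtain ⟨B₀', M₄, hB₀', hM₄, hT⟩ := h4 σ₀ hσ₀ le_rfl (1 / 2) (by norm_num) (by norm_num)
  have hdL : (1 : ℝ) ≤ ((d : ℝ) + 1) * ((ℓ : ℝ) + 1) :=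
    one_le_mul_of_one_le_of_one_le (le_add_of_nonneg_left (Nat.cast_nonneg d)) (le_add_of_nonneg_left (Nat.cast_nonneg ℓ))
  refine ⟨M₄, 5 * ((d : ℝ) + 1) * ((ℓ : ℝ) + 1) * B₀' + 1, hM₄, ?_, fun M hM B₁' hB₁' => ?_⟩
  · have : (1 : ℝ) ≤ 5 * (((d : ℝ) + 1) * ((ℓ : ℝ) + 1)) * B₀' := by
      calc (1 : ℝ) ≤ 5 * (((d : ℝ) + 1) * ((ℓ : ℝ) + 1)) * 1 := by linarith
        _ ≤ 5 * (((d : ℝ) + 1) * ((ℓ : ℝ) + 1)) * B₀' := mul_le_mul_of_nonneg_left hB₀' (by positivity)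
    linarith
  refine ⟨1, one_pos, ?_⟩
  intro i α₀ α₁ hα₀ hα₁ _ U₀ A' _ _ hAx h166
  dsimp only [v1GF] at A' hAx h166 ⊢
  have hMt : M₄ ≤ ((ℓ : ℝ) + 1) * i.Mh := hM.trans i.hM
  have hs : 0 < α₀ + α₁ := add_pos hα₀ hα₁
  obtain ⟨⟨n, ⟨hn, hLan⟩, huniq⟩, hall⟩ := hT i.m i.K i.hN i.D i.hk i.hk1 i.hMha i.hM8 i.hR2 i.hP5 i.hℓ4 hMt i.hcf i.hw i.hwb
    A' α₀ α₁ hα₀.le hα₁.le (fun b => (hAx b).le) (fun c => (h166 c).le)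
  obtain ⟨h37, -, hA1, -, -, -, -, -, -⟩ := hall n hn hLan
  refine ⟨n, hn, ⟨fun c => ?_, hLan, ?_⟩, fun n' hn' _ hLan' _ => huniq n' ⟨hn', hLan'⟩⟩
  · rw [h37]
    exact h166 c
  · have h1 : 5 * ((d : ℝ) + 1) * ((ℓ : ℝ) + 1) * B₀' * (α₀ + α₁) < B₁' * (α₀ + α₁) := by nlinarith
    exact lt_of_le_of_lt hA1 h1

end Thm4

/-! ## §3 Theorem 2 (p. 83) as the abstract leaf `Prop` on the instance -/

section Thm2

/-- **`B8.Thm2Printed` ON THE `k`-LEVEL V1 TORUS FAMILY AT `U₀ = 1`.**  Print (p. 83, verbatim in `B8.Thm2Printed`): *"There exist constants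
B₁, B₂(β₀), c₁ such that for arbitrary U₀, U′U₀ satisfying (1.33)–(1.35) with α₀ + α₁ ≤ c₁ there exists exactly one gauge transformation u
satisfying (1.29) and such that the conditions (1.36)–(1.39) hold for the configuration U₁ = U′^{u⁻¹}."*  For every family parameter
`M ≥ M₀`: the abstract sentence holds (first conjunct), and — second conjunct — its BODY holds with `B₁ = 5dLB′₀ + 1` at EVERY `B₂ > 0` (the
Hölder member of (1.36), whose constant `B₂(β₀)` is, is not part of the instance): ∃! restricted Landau `λ` (uniqueness among ALL restricted
Landau competitors, stronger than print's clause), (1.36) `|A|₍₋₁₎, |∇^η_{U₀}A|₍₋₂₎ < B₁(α₀ + α₁)`, (1.37), (1.38), (1.39) `|D^{η*}D^ηA|(b) <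
B₁(α₀ + α₁)((L^{j(b)})η)⁻³`, `|Δ^ηA|₍₋₃₎ < B₁(α₀ + α₁)` — all members of `thm4_multiLevelTorus_V1` at `(α₀, α₁)`, strict by the `+1`.
[cite: Balaban1985RegularSpaces, Thm 2 p.83, (1.29) p.81, (1.36)–(1.38) p.82, (1.39) p.83; Balaban1984PropagatorsII, (2.7) p.224, (2.12) p.225] -/
theorem thm2Printed_v1 (d ℓ : ℕ) (hd : 1 ≤ d + 1) (hL : Odd (ℓ + 1) ∧ 1 < ℓ + 1) {b₀ b₁ : ℝ} (hb₀ : 0 < b₀) (hb₁ : b₀ ≤ b₁) :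
    ∃ M₀ B₁ : ℝ, 0 < M₀ ∧ 1 ≤ B₁ ∧ ∀ M : ℝ, M₀ ≤ M →
      B8.Thm2Printed (fun i : V1Idx d ℓ hd hL b₀ b₁ M => (v1GF i).toGFData) ∧
      ∀ B₂ : ℝ, 0 < B₂ → ∃ c₁ : ℝ, 0 < c₁ ∧
        ∀ i : V1Idx d ℓ hd hL b₀ b₁ M, ∀ α₀ α₁ : ℝ, 0 < α₀ → 0 < α₁ → α₀ + α₁ ≤ c₁ →
          ∀ U₀ : (v1GF i).Cfg, ∀ U' : (v1GF i).Pert,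
            (v1GF i).InA α₀ U₀ → (v1GF i).Reg335 α₀ U₀ → (v1GF i).InAAx α₀ U₀ U' → (v1GF i).avgClose α₁ U₀ U' →
              ∃ u : (v1GF i).GT, (v1GF i).Restricted U₀ u ∧
                ((v1GF i).C136 B₁ B₂ (α₀ + α₁) U₀ ((v1GF i).act U' u) ∧ (v1GF i).C137 α₁ U₀ ((v1GF i).act U' u) ∧
                  (v1GF i).Landau U₀ ((v1GF i).act U' u) ∧ (v1GF i).C139 B₁ (α₀ + α₁) U₀ ((v1GF i).act U' u)) ∧
                ∀ u' : (v1GF i).GT, (v1GF i).Restricted U₀ u' →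
                  (v1GF i).C136 B₁ B₂ (α₀ + α₁) U₀ ((v1GF i).act U' u') → (v1GF i).C137 α₁ U₀ ((v1GF i).act U' u') →
                  (v1GF i).Landau U₀ ((v1GF i).act U' u') → (v1GF i).C139 B₁ (α₀ + α₁) U₀ ((v1GF i).act U' u') →
                    u' = u := by
  obtain ⟨σ₀, hσ₀, h4⟩ := thm4_multiLevelTorus_V1 d ℓ hd hL hb₀ hb₁
  obtain ⟨B₀', M₄, hB₀', hM₄, hT⟩ := h4 σ₀ hσ₀ le_rfl (1 / 2) (by norm_num) (by norm_num)
  have hdL : (1 : ℝ) ≤ ((d : ℝ) + 1) * ((ℓ : ℝ) + 1) :=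
    one_le_mul_of_one_le_of_one_le (le_add_of_nonneg_left (Nat.cast_nonneg d)) (le_add_of_nonneg_left (Nat.cast_nonneg ℓ))
  have hB₁ : (1 : ℝ) ≤ 5 * ((d : ℝ) + 1) * ((ℓ : ℝ) + 1) * B₀' + 1 := by
    have : (1 : ℝ) ≤ 5 * (((d : ℝ) + 1) * ((ℓ : ℝ) + 1)) * B₀' := by
      calc (1 : ℝ) ≤ 5 * (((d : ℝ) + 1) * ((ℓ : ℝ) + 1)) * 1 := by linarith
        _ ≤ 5 * (((d : ℝ) + 1) * ((ℓ : ℝ) + 1)) * B₀' := mul_le_mul_of_nonneg_left hB₀' (by positivity)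
    linarith
  -- the body at every `B₂ > 0` (the Hölder member of (1.36) is not part of the instance)
  have body : ∀ M : ℝ, M₄ ≤ M → ∀ B₂ : ℝ, 0 < B₂ → ∃ c₁ : ℝ, 0 < c₁ ∧
      ∀ i : V1Idx d ℓ hd hL b₀ b₁ M, ∀ α₀ α₁ : ℝ, 0 < α₀ → 0 < α₁ → α₀ + α₁ ≤ c₁ →
        ∀ U₀ : (v1GF i).Cfg, ∀ U' : (v1GF i).Pert,
          (v1GF i).InA α₀ U₀ → (v1GF i).Reg335 α₀ U₀ → (v1GF i).InAAx α₀ U₀ U' → (v1GF i).avgClose α₁ U₀ U' →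
            ∃ u : (v1GF i).GT, (v1GF i).Restricted U₀ u ∧
              ((v1GF i).C136 (5 * ((d : ℝ) + 1) * ((ℓ : ℝ) + 1) * B₀' + 1) B₂ (α₀ + α₁) U₀ ((v1GF i).act U' u) ∧
                (v1GF i).C137 α₁ U₀ ((v1GF i).act U' u) ∧
                (v1GF i).Landau U₀ ((v1GF i).act U' u) ∧
                (v1GF i).C139 (5 * ((d : ℝ) + 1) * ((ℓ : ℝ) + 1) * B₀' + 1) (α₀ + α₁) U₀ ((v1GF i).act U' u)) ∧
              ∀ u' : (v1GF i).GT, (v1GF i).Restricted U₀ u' →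
                (v1GF i).C136 (5 * ((d : ℝ) + 1) * ((ℓ : ℝ) + 1) * B₀' + 1) B₂ (α₀ + α₁) U₀ ((v1GF i).act U' u') →
                (v1GF i).C137 α₁ U₀ ((v1GF i).act U' u') →
                (v1GF i).Landau U₀ ((v1GF i).act U' u') →
                (v1GF i).C139 (5 * ((d : ℝ) + 1) * ((ℓ : ℝ) + 1) * B₀' + 1) (α₀ + α₁) U₀ ((v1GF i).act U' u') → u' = u := by
    intro M hM B₂ hB₂
    refine ⟨1, one_pos, ?_⟩
    intro i α₀ α₁ hα₀ hα₁ _ U₀ A' _ _ hAx hcl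
    dsimp only [v1GF] at A' hAx hcl ⊢
    have hMt : M₄ ≤ ((ℓ : ℝ) + 1) * i.Mh := hM.trans i.hM
    have hs : 0 < α₀ + α₁ := add_pos hα₀ hα₁
    have hη : 0 < |i.cf|⁻¹ := inv_pos.2 (abs_pos.2 i.hcf)
    obtain ⟨⟨n, ⟨hn, hLan⟩, huniq⟩, hall⟩ := hT i.m i.K i.hN i.D i.hk i.hk1 i.hMha i.hM8 i.hR2 i.hP5 i.hℓ4 hMt i.hcf i.hw i.hwb
      A' α₀ α₁ hα₀.le hα₁.le (fun b => (hAx b).le) (fun c => (hcl c).le)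
    obtain ⟨h37, -, hA1, hA2, hJ3, hA4, -, -, -⟩ := hall n hn hLan
    have hbump : 5 * ((d : ℝ) + 1) * ((ℓ : ℝ) + 1) * B₀' * (α₀ + α₁) <
        (5 * ((d : ℝ) + 1) * ((ℓ : ℝ) + 1) * B₀' + 1) * (α₀ + α₁) := by nlinarith
    refine ⟨n, hn, ⟨⟨lt_of_le_of_lt hA1 hbump, lt_of_le_of_lt hA2 hbump⟩, fun c => ?_, hLan, ⟨fun b => ?_,
      lt_of_le_of_lt hA4 hbump⟩⟩, fun n' hn' _ _ hLan' _ => huniq n' ⟨hn', hLan'⟩⟩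
    · rw [h37]
      exact hcl c
    · have hw3 : 0 < (((geomT i.D).len (blkV1 i.hN i.D b) * |i.cf|⁻¹) ^ 3)⁻¹ :=
        inv_pos.2 (pow_pos (mul_pos (lenT_pos i.D _) hη) 3)
      exact lt_of_le_of_lt (hJ3 b) (mul_lt_mul_of_pos_right hbump hw3)
  refine ⟨M₄, 5 * ((d : ℝ) + 1) * ((ℓ : ℝ) + 1) * B₀' + 1, hM₄, hB₁, fun M hM => ⟨?_, body M hM⟩⟩
  obtain ⟨c₁, hc₁, H⟩ := body M hM 1 one_pos
  exact ⟨5 * ((d : ℝ) + 1) * ((ℓ : ℝ) + 1) * B₀' + 1, 1, c₁, by linarith, one_pos, hc₁, H⟩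

end Thm2

/-! ## §4 Proposition 3 (p. 87) as the abstract leaf `Prop` on the instance -/

section Prop3

/-- **`B8.Prop3Printed (d+1) L C₂ inp B₀(β₀)` ON THE `k`-LEVEL V1 TORUS FAMILY AT `U₀ = 1`.**  Print (p. 87, verbatim in `B8.Prop3Body`):
*"If U₀, U₁U₀ satisfy (1.40)–(1.42) with α₀, α₁, α₂ bounded by a constant depending on d and L only, and α₂ satisfies the additional
restriction (1.61), then U₁ satisfies (1.36)–(1.39) with B₁ = 5dLB₀, B₂(β₀) = 5dLB₀(β₀), where B₀, B₀(β₀) are the corresponding norms of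
the operators G(U₀), H(U₀), and depend on d and L only, B₀(β₀) on β₀ also."*  There are ONE threshold `M₀ > 0` and ONE `B′₀ ≥ 1` (r05's
`K_L(B₀A + 1)(1 + 2b₁)`, the norm of the genuine `k`-level `G(1)` in print's currency) such that for every `M ≥ M₀`, every `C₂ ≥ 0` (the
constant of Prop. 4 of [3] in (1.56)), every `B₀(β₀)` and every B9-input record `inp` with `inp.B₀ = B′₀ + 1`, the abstract sentence holds
for `fun i : V1Idx … M => (v1GF i).toGFData2`, with Prop. 3's threshold `c := min(1∕(72(d+1)B′₀), 1∕(50(d+1)))`: the instance's (1.40)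
(`InAPair`: `|D^{η*}D^ηA| < 2α₀(…)⁻³`), (1.42) (`Landau`, `C137`) feed `prop3_multiLevelTorus_V1_P26_vector` with `J := D^{η*}D^ηA`,
`n_J = 2α₀`, `B := QA`, `n_B = 2dLα₁`; its size lines (1.55)∕(1.56) hold with room (`α₂`-terms `≥ 0`, `C₂α₂² ≥ 0`), the side conditions
«B₀36dα₂ ≦ 1∕2» (p. 86) and `50dα₂ ≦ 1` (census C-B8-8) come from `α₂ ≤ c`, (1.61) is print's; conclusions (1.36) (two sup members) and
(1.39) with `5dL(B′₀ + 1)(α₀ + α₁)`, strict.  The (1.41) hypothesis `C162 1 α₂` is not needed at `U₀ = 1` (it enters print's proof only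
through the α₂-terms of (1.55), absent in the linear chart). [cite: Balaban1985RegularSpaces, Prop. 3 p.87, (1.40)–(1.42) pp.83–84, (1.55)–(1.56) + (1.61) p.86, (1.59)–(1.62) pp.86–87; Balaban1984PropagatorsII, Prop. 2.6 (2.136) p.247] -/
theorem prop3Printed_v1 (d ℓ : ℕ) (hd : 1 ≤ d + 1) (hL : Odd (ℓ + 1) ∧ 1 < ℓ + 1) {b₀ b₁ : ℝ} (hb₀ : 0 < b₀) (hb₁ : b₀ ≤ b₁) :
    ∃ M₀ B₀' : ℝ, 0 < M₀ ∧ 1 ≤ B₀' ∧ ∀ M : ℝ, M₀ ≤ M → ∀ C₂ : ℝ, 0 ≤ C₂ → ∀ (B₀β : ℝ) (inp : B8.B9Inputs), inp.B₀ = B₀' + 1 →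
      B8.Prop3Printed (d + 1) ((ℓ : ℝ) + 1) C₂ inp B₀β (fun i : V1Idx d ℓ hd hL b₀ b₁ M => (v1GF i).toGFData2) := by
  obtain ⟨σ₀, hσ₀, h3⟩ := prop3_multiLevelTorus_V1_P26_vector d ℓ hd hL hb₀ hb₁
  obtain ⟨B₀, KL, hB₀, hKL, Amaj, M₄, hA, hM₄, hP3⟩ := h3 σ₀ hσ₀ le_rfl (1 / 2) (by norm_num) (by norm_num)
  have hb₁0 : 0 ≤ b₁ := hb₀.le.trans hb₁
  have hBV : (1 : ℝ) ≤ KL * ((B₀ * Amaj + 1) * (1 + 2 * b₁)) := by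
    have h1 : (1 : ℝ) ≤ B₀ * Amaj + 1 := le_add_of_nonneg_left (mul_nonneg (zero_le_one.trans hB₀) hA)
    have h2 : (1 : ℝ) ≤ 1 + 2 * b₁ := le_add_of_nonneg_right (by positivity)
    exact one_le_mul_of_one_le_of_one_le hKL (one_le_mul_of_one_le_of_one_le h1 h2)
  refine ⟨M₄, KL * ((B₀ * Amaj + 1) * (1 + 2 * b₁)), hM₄, hBV, fun M hM C₂ hC₂ B₀β inp hinp => ?_⟩
  have hdP : (0 : ℝ) < (d : ℝ) + 1 := by positivity
  have hBpos : (0 : ℝ) < KL * ((B₀ * Amaj + 1) * (1 + 2 * b₁)) := zero_lt_one.trans_le hBV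
  -- the threshold of Prop. 3 («α₀, α₁, α₂ bounded by a constant depending on d and L only»): the two side conditions of the a-priori algebra
  refine ⟨min (1 / (72 * ((d : ℝ) + 1) * (KL * ((B₀ * Amaj + 1) * (1 + 2 * b₁))))) (1 / (50 * ((d : ℝ) + 1))), by positivity, ?_⟩
  intro i α₀ α₁ α₂ hα₀ _ hα₁ _ hα₂ hα₂c h61 U₀ A _ _ hPair _ hLan h137
  dsimp only [v1GF] at A hPair hLan h137 ⊢
  have hMt : M₄ ≤ ((ℓ : ℝ) + 1) * i.Mh := hM.trans i.hM
  have hs : 0 < α₀ + α₁ := add_pos hα₀ hα₁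
  have hη : 0 < |i.cf|⁻¹ := inv_pos.2 (abs_pos.2 i.hcf)
  have hdL : (1 : ℝ) ≤ ((d : ℝ) + 1) * ((ℓ : ℝ) + 1) :=
    one_le_mul_of_one_le_of_one_le (le_add_of_nonneg_left (Nat.cast_nonneg d)) (le_add_of_nonneg_left (Nat.cast_nonneg ℓ))
  have hcast : ((d + 1 : ℕ) : ℝ) = (d : ℝ) + 1 := by push_cast; ring
  -- the size lines of the a-priori algebra at `U₀ = 1` in the linear chart (no α₂-terms are needed: `n_J = 2α₀`, `n_B = 2dLα₁`)
  have hmsup : 0 ≤ msup (ℓ + 1) i.k |i.cf|⁻¹ (-2)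
      (fun j (p : Fin (d + 1) × PBond (PV d ℓ i.m i.K hd hL) 0) => j ≤ (blkV1 i.hN i.D p.2).1.1)
      (fun p : Fin (d + 1) × PBond (PV d ℓ i.m i.K hd hL) 0 => DV (P := PV d ℓ i.m i.K hd hL) p.1 i.cf (WithLp.ofLp A) p.2) :=
    msup_nonneg _ _ hη.le _ _ _
  have h55s : 2 * α₀ ≤ 2 * α₀ + 36 * ((d : ℝ) + 1) * α₂ *
      msup (ℓ + 1) i.k |i.cf|⁻¹ (-2) (fun j (p : Fin (d + 1) × PBond (PV d ℓ i.m i.K hd hL) 0) => j ≤ (blkV1 i.hN i.D p.2).1.1)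
        (fun p : Fin (d + 1) × PBond (PV d ℓ i.m i.K hd hL) 0 => DV (P := PV d ℓ i.m i.K hd hL) p.1 i.cf (WithLp.ofLp A) p.2) +
      50 * ((d : ℝ) + 1) * α₂ ^ 3 + 10 * ((d : ℝ) + 1) * α₀ * α₂ := by
    have h1 : 0 ≤ 36 * ((d : ℝ) + 1) * α₂ *
        msup (ℓ + 1) i.k |i.cf|⁻¹ (-2) (fun j (p : Fin (d + 1) × PBond (PV d ℓ i.m i.K hd hL) 0) => j ≤ (blkV1 i.hN i.D p.2).1.1)
          (fun p : Fin (d + 1) × PBond (PV d ℓ i.m i.K hd hL) 0 => DV (P := PV d ℓ i.m i.K hd hL) p.1 i.cf (WithLp.ofLp A) p.2) :=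
      mul_nonneg (by positivity) hmsup
    have h2 : 0 ≤ 50 * ((d : ℝ) + 1) * α₂ ^ 3 := by positivity
    have h3 : 0 ≤ 10 * ((d : ℝ) + 1) * α₀ * α₂ := by positivity
    linarith
  have h56s : 2 * ((d : ℝ) + 1) * ((ℓ : ℝ) + 1) * α₁ ≤ 2 * ((d : ℝ) + 1) * ((ℓ : ℝ) + 1) * α₁ + C₂ * α₂ ^ 2 :=
    le_add_of_nonneg_right (mul_nonneg hC₂ (sq_nonneg _))
  have hside : 36 * ((d : ℝ) + 1) * (KL * ((B₀ * Amaj + 1) * (1 + 2 * b₁))) * α₂ ≤ 1 / 2 := by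
    have hc1 : α₂ ≤ 1 / (72 * ((d : ℝ) + 1) * (KL * ((B₀ * Amaj + 1) * (1 + 2 * b₁)))) := hα₂c.trans (min_le_left _ _)
    calc 36 * ((d : ℝ) + 1) * (KL * ((B₀ * Amaj + 1) * (1 + 2 * b₁))) * α₂
        ≤ 36 * ((d : ℝ) + 1) * (KL * ((B₀ * Amaj + 1) * (1 + 2 * b₁))) *
            (1 / (72 * ((d : ℝ) + 1) * (KL * ((B₀ * Amaj + 1) * (1 + 2 * b₁))))) := mul_le_mul_of_nonneg_left hc1 (by positivity)
      _ = 1 / 2 := by field_simp; ring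
  have h50 : 50 * ((d : ℝ) + 1) * α₂ ≤ 1 := by
    have hc2 : α₂ ≤ 1 / (50 * ((d : ℝ) + 1)) := hα₂c.trans (min_le_right _ _)
    calc 50 * ((d : ℝ) + 1) * α₂ ≤ 50 * ((d : ℝ) + 1) * (1 / (50 * ((d : ℝ) + 1))) := mul_le_mul_of_nonneg_left hc2 (by positivity)
      _ = 1 := by field_simp
  have h61' : 2 * α₂ ^ 2 + 20 * ((d : ℝ) + 1) * α₀ * α₂ + 2 * C₂ * α₂ ^ 2 ≤ α₀ + α₁ := by
    rw [hcast] at h61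
    exact h61
  -- Proposition 3 at `U₀ = 1` on the `k`-level V1 torus (r05), fed with `J := D*DA`, `B := QA`
  obtain ⟨hA1, hA2, hJ3, hA4, -, -, -⟩ := hP3 i.m i.K i.hN i.D i.hk i.hk1 i.hMha i.hM8 i.hR2 i.hP5 i.hℓ4 hMt i.hcf i.hw i.hwb
    A (dcsE i.cf (dcE i.cf A)) (QE (domT i.hN i.D i.hk) A) rfl hLan rfl (2 * α₀) (2 * ((d : ℝ) + 1) * ((ℓ : ℝ) + 1) * α₁)
    (by positivity) (by positivity) (fun b => (hPair b).le) (fun c => (h137 c).le) ((d : ℝ) + 1) ((ℓ : ℝ) + 1) C₂ α₀ α₁ α₂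
    hdP.le hdL hα₀.le hα₁.le hα₂.le h55s h56s hside h50 h61'
  -- the strict printed inequalities with the constant `B₀′ + 1`
  have hbump : 5 * ((d : ℝ) + 1) * ((ℓ : ℝ) + 1) * (KL * ((B₀ * Amaj + 1) * (1 + 2 * b₁))) * (α₀ + α₁) <
      5 * ((d + 1 : ℕ) : ℝ) * ((ℓ : ℝ) + 1) * inp.B₀ * (α₀ + α₁) := by
    rw [hcast, hinp]
    have : 0 < 5 * ((d : ℝ) + 1) * ((ℓ : ℝ) + 1) * (α₀ + α₁) := by positivity
    nlinarith
  refine ⟨⟨lt_of_le_of_lt hA1 hbump, lt_of_le_of_lt hA2 hbump⟩, fun b => ?_, lt_of_le_of_lt hA4 hbump⟩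
  have hw3 : 0 < (((geomT i.D).len (blkV1 i.hN i.D b) * |i.cf|⁻¹) ^ 3)⁻¹ :=
    inv_pos.2 (pow_pos (mul_pos (lenT_pos i.D _) hη) 3)
  calc |dcsE i.cf (dcE i.cf A) b| ≤ 2 * α₀ * (((geomT i.D).len (blkV1 i.hN i.D b) * |i.cf|⁻¹) ^ 3)⁻¹ := (hPair b).le
    _ ≤ 5 * ((d : ℝ) + 1) * ((ℓ : ℝ) + 1) * (KL * ((B₀ * Amaj + 1) * (1 + 2 * b₁))) * (α₀ + α₁) *
          (((geomT i.D).len (blkV1 i.hN i.D b) * |i.cf|⁻¹) ^ 3)⁻¹ := mul_le_mul_of_nonneg_right hJ3 hw3.le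
    _ < 5 * ((d + 1 : ℕ) : ℝ) * ((ℓ : ℝ) + 1) * inp.B₀ * (α₀ + α₁) * (((geomT i.D).len (blkV1 i.hN i.D b) * |i.cf|⁻¹) ^ 3)⁻¹ :=
        mul_lt_mul_of_pos_right hbump hw3

end Prop3

/-! ## §5 Non-vacuity of the index at every threshold -/

section NonVacuity

/-- **THE FAMILY IS INHABITED AT EVERY THRESHOLD**: for every `d`, every odd `L = ℓ + 1 ≥ 5`, every `k ≥ 2`, every real `M` and every band
`0 < b₀ ≤ b₁` there is an index `i : V1Idx d ℓ hd hL b₀ b₁ M` with `i.k = k` — torus `P′_μ = 2L²` (`≥ 5L`), `R = 2L²`, `M_h = L^a ≥ 8` with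
`M ≤ L·M_h` (`B6KLevelFamilyWitnessV1.exists_exponent`), `m = k + a + 3`, `K = 0`, `c′ = 1`, band weights (`globalBand_witness`) — whose
nested family has sites at BOTH top levels `k` and `k − 1` (`B6V1TorusWitness.exists_twoTop_TDomains`: `Ω₁ = … = Ω_{k−1} = T_η`, `Ω_k` = the
big `k`-block at the origin; print p. 77 «we admit the case where some domains Ω_j are equal to T_η»).
[cite: Balaban1984PropagatorsII, (2.1)–(2.4) p.224, (2.16) p.225; Balaban1985RegularSpaces, p.77] -/
theorem exists_v1Idx (d ℓ : ℕ) (hd : 1 ≤ d + 1) (hL : Odd (ℓ + 1) ∧ 1 < ℓ + 1) (hℓ4 : 4 ≤ ℓ) (k : ℕ) (hk : 2 ≤ k)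
    (M : ℝ) {b₀ b₁ : ℝ} (hb₀ : 0 < b₀) (hb₁ : b₀ ≤ b₁) :
    ∃ i : V1Idx d ℓ hd hL b₀ b₁ M, i.k = k ∧
      (∃ x ∈ boxDom (N0 ℓ i.Mh i.k i.P'), i.D.lev x = k) ∧ (∃ x ∈ boxDom (N0 ℓ i.Mh i.k i.P'), i.D.lev x = k - 1) := by
  obtain ⟨a, h8, hM₂, -⟩ := exists_exponent ℓ (by omega) M 0 (2 * (ℓ + 1) ^ 2) (Nat.one_le_iff_ne_zero.mpr (by positivity))
  have hMh : 1 ≤ (ℓ + 1) ^ a := Nat.one_le_pow _ _ (by omega)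
  set P' : Fin (d + 1) → ℕ := fun _ => 2 * (ℓ + 1) ^ 2 with hP'
  have hP2 : ∀ μ : Fin (d + 1), 2 ≤ P' μ := fun μ => by simp only [hP']; nlinarith
  obtain ⟨D, hD⟩ := exists_twoTop_TDomains d ℓ ((ℓ + 1) ^ a) k P' (2 * (ℓ + 1) ^ 2) hk
  have hN : ∀ μ, N0 ℓ ((ℓ + 1) ^ a) k P' μ = (PV d ℓ (k + a + 3) 0 hd hL).sitesPerDir 0 :=
    fun μ => N0_V1_pow ℓ k a 2 (k + a + 3) 0 hd hL (by ring) μ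
  have hk' : k ≤ k + a + 3 + 0 := by omega
  obtain ⟨w, hw, hwb⟩ := globalBand_witness (domT hN D hk') hb₀ hb₁
  refine ⟨⟨k + a + 3, 0, (ℓ + 1) ^ a, k, 2 * (ℓ + 1) ^ 2, a, P', hN, D, hk', by omega, rfl, h8, le_rfl,
    fun μ => by simp only [hP']; nlinarith, hℓ4, by simpa using hM₂, 1, one_ne_zero, w, hw, hwb⟩, rfl, ?_, ?_⟩
  · refine ⟨0, ?_, by rw [hD]; exact topLev_zero ℓ k _⟩
    rw [mem_boxDom]; intro μ
    have := B6MultiLevelTorusOperator.one_le_N0 (ℓ := ℓ) (k := k) hMh (fun μ => le_trans (by norm_num) (hP2 μ)) μ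
    simp only [Pi.zero_apply]; exact ⟨le_rfl, by exact_mod_cast this⟩
  · exact ⟨_, corner_mem_boxDom ℓ k _ _ hMh hP2, by rw [hD]; exact topLev_corner ℓ k _ hMh⟩

end NonVacuity

/-! ## §6 Theorem 2 by the knit's printed route «Theorem 4 + Proposition 3 + (1.65) ⇒ Theorem 2» on the instance -/

section KnitRoute

/-- **THEOREM 2 ON THE INSTANCE BY THE N05 KNIT'S ROUTE** (p. 88, verbatim: *"Thus Theorem 4 implies Theorem 2"*; kernel form
`B8.thm2_of_thm4_prop3`, whose hypothesis list IS the gauge-fixing part of `B8LeafKnit.b8LeafR_knit`): for `M ≥ max(M₀(Thm 4), M₀(Prop 3))`,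
`B8.thm2_of_thm4_prop3 (d+1) L 0 B′₁ inp 1 (fun i => (v1GF i).toGFData2)` with §2's Theorem 4 at `B′₁ := max(B₁m, 5(d+1)L·inp.B₀)`, §4's
Proposition 3 (`C₂ = 0`, `B₀(β₀) = 1`, `inp.B₀ = B′₀ + 1`), `c₀ := 1` and the six laws of §1 proves `B8.Thm2Printed` for the family a second
time — the knit's law list and the sub-cell's smallness schedule `B8.thm2_schedule_exists` run on a non-degenerate family.
[cite: Balaban1985RegularSpaces, «Thm 4 ⇒ Thm 2» p.88, Thm 2 p.83, Prop. 3 p.87, Thm 4 p.88, (1.65) p.88] -/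
theorem thm2Printed_v1_knit (d ℓ : ℕ) (hd : 1 ≤ d + 1) (hL : Odd (ℓ + 1) ∧ 1 < ℓ + 1) {b₀ b₁ : ℝ} (hb₀ : 0 < b₀)
    (hb₁ : b₀ ≤ b₁) :
    ∃ M₀ : ℝ, 0 < M₀ ∧ ∀ M : ℝ, M₀ ≤ M → B8.Thm2Printed (fun i : V1Idx d ℓ hd hL b₀ b₁ M => (v1GF i).toGFData) := by
  obtain ⟨M₄, B₁m, hM₄, hB₁m, h4⟩ := thm4Printed_v1 d ℓ hd hL hb₀ hb₁
  obtain ⟨M₃, B₀', hM₃, hB₀', h3⟩ := prop3Printed_v1 d ℓ hd hL hb₀ hb₁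
  refine ⟨max M₄ M₃, lt_max_of_lt_left hM₄, fun M hM => ?_⟩
  let inp : B8.B9Inputs := ⟨B₀' + 1, 1, by linarith, one_pos⟩
  have p3 := h3 M (le_trans (le_max_right _ _) hM) 0 le_rfl 1 inp rfl
  have t4 := h4 M (le_trans (le_max_left _ _) hM) (max B₁m (5 * ((d + 1 : ℕ) : ℝ) * ((ℓ : ℝ) + 1) * (B₀' + 1))) (le_max_left _ _)
  exact B8.thm2_of_thm4_prop3 (d + 1) ((ℓ : ℝ) + 1) 0 _ inp 1 (fun i : V1Idx d ℓ hd hL b₀ b₁ M => (v1GF i).toGFData2)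
    (by omega) (by positivity) one_pos le_rfl (le_max_right _ _) t4 p3 1 one_pos
    (fun i α₀ α₁ U₀ U' h0 hc hA hAx hcl => avgClose166_of_avgClose i 1 α₀ α₁ U₀ U' h0 hc hA hAx hcl)
    (fun i α₀ U₀ U' u hAx => inAPair_act i α₀ U₀ U' u hAx)
    (fun i α₁ b s U₀ U' u hcl hu h162 => c137_act i α₁ b s U₀ U' u hcl hu h162)
    (fun i b b₂ s U₀ U₁ h => c136_c162 i b b₂ s U₀ U₁ h)
    (fun i b s b' s' U₀ U₁ hle h => c162_mono i b s b' s' U₀ U₁ hle h)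
    (fun i α₁ α₁' U₀ U₁ hle h => c137_mono i α₁ α₁' U₀ U₁ hle h)

end KnitRoute

end

end Literature.MathematicalPhysics.QuantumFieldTheory.Balaban1983to89.B8LeafModelV1
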